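import Literature.Geometry.Lorentzian.AsymptoticFlatness
import Literature.Geometry.Lorentzian.ADMTailGaugeReducible
import Literature.Geometry.Lorentzian.ADMTailForcingDecay
import HarnessLib

/-!
# The analytic clauses of the quasi final state hypothesis (Ellithy 2026, Definition 4.4)

A. Ellithy, *The spacetime Penrose inequality under a quasi final state hypothesis*,
arXiv:2605.18730 (2026), §4.1 and Definition 4.4 (pp. 38–40).

**§4.1** (p. 38): "We choose the asymptotic rest frame of this timelike ADM four-momentum.
Equivalently, after an asymptotic Lorentz transformation of the asymptotically flat end, the ADM
linear momentum `P_ADM` vanishes … We then choose a smooth Cauchy temporal function `t` whose level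
sets `Σ_t` are asymptotically Euclidean Cauchy hypersurfaces adapted to this rest-frame asymptotic
coordinate system. … In this chosen asymptotic frame the ADM linear momentum of the end is zero".

**Definition 4.4** (Quasi final state hypothesis, p. 39): "there exist numbers `T̲ > 0`, `r₀ > 0`,
`τ ∈ (1/2, 1)`, such that the following hold.
* Last smooth horizon piece and late-time exterior chart. The closure of the exterior region of
  `𝓗_final` admits a late-time `C²` coordinate system `(t, r, p) ∈ (T̲, ∞) × [r₀, ∞) × S²` with
  `𝓗_final = {r = r₀}` … On the exterior region `r > r₀`, the metric takes the general ADM form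
  `g = -(N² - |β|²_{g_t}) dt² + 2 β ⊙ dt + g_t`, `g_t = (λ² + |b|²_γ) dr² + 2 b ⊙ dr + γ`, and the
  coefficient tuple belongs to the class `𝒞𝒮♯_{-τ}(ℳ)` from Definition 3.8, where
  `ℳ = (T̲, ∞) × (r₀, ∞) × S²`.
* Late-time forcing decay and gauge reducibility. The coefficient tuple `𝒮` is late-time gauge
  reducible in the sense of Definition 3.29; that is for every `r₁ > r₀`, `𝔅♯(T; r₁) → 0` as
  `T → ∞`. Moreover, the late-time forcing decay assumptions from Definition 3.28 hold: namely (A1)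
  holds, and in addition either (A2) or (A3) holds.
* Late-time area stabilization of the horizon. …"

This file types the ANALYTIC content of Def. 4.4 — bullet 1's ADM-form and tail-class clauses and
bullet 2 — together with §4.1's rest-frame normalisation of the slices, for a late chart
`Φ : (t, r, p) ↦ Φ(t, r, p)` of a manifold `M` carrying a field of bilinear forms `g` (the spacetime
metric), as ONE predicate `IsQuasiFinalAnalytic I g Φ T̲ r₀` (D37′ of the `decomp-fsc` cell: the
intended instantiation of the parameter `QFA : FrameProperty` of the cell's `QuasiFinalFrame`
ledger, whose GEOMETRIC clauses — bullet 1's horizon `{r = r₀}`, MOTS sections, outermostness,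
bullet 3's area limit — are typed there and are NOT repeated here):

* `polarChart Φ (t, y) = Φ(t, ‖y‖, y/‖y‖)` — the chart read in Cartesian slice coordinates;
* `HasADMForm I g Φ T̲ r₀ 𝒮` — "on the exterior region `r > r₀` the metric takes the general ADM form"
  with coefficient tuple `𝒮`: `(Φ ∘ polar)^* g = admForm 𝒮` on `{t > T̲} × {‖y‖ > r₀}`;
* `ADMTailTuple.sliceMomentumFlux`, `ADMTailTuple.IsRestFrame` — §4.1: the ADM linear momentum
  fluxes `P_i(R) = (8π)⁻¹ ∮_{S_R} ∑_j (K_ij - (tr K) g_ij) x^j/R dσ` of every slice `(Σ_t, g(t), K_t)`,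
  `t > T̲`, tend to `0` (the formula of `AFEnd.admMomentumFlux`, `AsymptoticFlatness`);
* `IsQuasiFinalAnalytic I g Φ T̲ r₀` — `r₀ > 0` and there are `α ∈ (0, 1)` (the Hölder exponent
  fixed "once and for all" in §3.1, p. 20), `τ ∈ (1/2, 1)` and a tuple `𝒮` with: ADM form, `𝒮 ∈
  𝒞𝒮♯_{-τ}(ℳ)` (`IsSharpTailCoeff`, Def. 3.8), gauge reducibility (`IsGaugeReducible`, Def. 3.29),
  forcing decay (A1) ∧ ((A2) ∨ (A3)) (`HasLateForcingDecay`, Def. 3.28), rest frame (§4.1).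

## Design / adapter

* Literature cannot import the cell's kernel; the predicate is stated for any model with corners
  `I` on the target manifold `M` and any `g : Π x, T_x M →L T_x M →L ℝ` (for a spacetime of the tree:
  `I = 𝓡 4`, `g = 𝒟.metric.val`), and the cell instantiates
  `QuasiFinalAnalytic : FrameProperty := fun … 𝒟 F ↦ IsQuasiFinalAnalytic (𝓡 4) 𝒟.metric.val F.Φ F.T F.r₀`.
* The pullback is taken along the polar composite `(t, y) ↦ Φ(t, ‖y‖, y/‖y‖)` on the flat model
  `𝓘(ℝ, ℝ × E3)` (`pullbackBilin`, `mfderiv`; honest where `Φ` is `C¹` and `‖y‖ > r₀ > 0`).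
* The print's normalisation `T̲ > 0` (a choice of time origin) is not imposed; `r₀ > 0` is.
* Typing a definition proves nothing: no fact of the paper (Thm. 3.31, Lemma 4.7, Thm. 7.1) is
  stated here.

## References

* [Ellithy2026] A. Ellithy, arXiv:2605.18730 (2026), §4.1 (p. 38), Definition 4.4 (pp. 39–40),
  Remark 4.5.
* R. Arnowitt, S. Deser, C. W. Misner (1962); R. Bartnik, J. Isenberg, *The constraint equations*
  (2004), §2 — the ADM linear momentum. [folklore]
-/

noncomputable section

set_option maxSynthPendingDepth 3

open Set Filter Metric MeasureTheory
open scoped ENNReal Topology Manifold RealInnerProductSpace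

namespace Literature.Geometry.Lorentzian

/-! ### §4.1: the slices are adapted to the ADM rest frame -/

namespace ADMTailTuple

variable (S : ADMTailTuple)

/-- `tr_{g(t)} K_t` at `y` (the mean curvature of the slice `M_t`, trace of `K_t` raised by `g(t)`).
[cite: Ellithy2026, §4.1 p. 38] -/
def sliceTrK (t : ℝ) (y : E3) : ℝ :=
  LinearMap.trace ℝ E3 (((S.gCart t y).inverse).comp (S.sliceK t y)).toLinearMap

/-- **The ADM linear momentum flux of the slice `(Σ_t, g(t), K_t)`** through the coordinate sphere
`‖y‖ = R` of the chart, component `i`: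
`P_i(R) = (8π)⁻¹ ∫_{‖x‖ = R} ∑_j (K_ij - (tr_g K) g_ij)(x) x^j / R dσ(x)` (`σ = μHE[2]`; the formula of
`AFEnd.admMomentumFlux`). [cite: Ellithy2026, §4.1 p. 38] -/
def sliceMomentumFlux (t : ℝ) (i : Fin 3) (R : ℝ) : ℝ :=
  (8 * Real.pi)⁻¹ *
    ∫ x in sphere (0 : E3) R,
      ∑ j : Fin 3, (S.sliceK t x (EuclideanSpace.single i 1) (EuclideanSpace.single j 1)
        - S.sliceTrK t x * S.gCart t x (EuclideanSpace.single i 1) (EuclideanSpace.single j 1)) *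
        x j / R
      ∂(μHE[2] : Measure E3)

/-- **The slices are adapted to the ADM rest frame** (Ellithy 2026, §4.1, p. 38: "in this chosen
asymptotic frame the ADM linear momentum of the end is zero"): for every `t > T̲` and every component
`i`, the momentum fluxes `P_i(R)` of `(Σ_t, g(t), K_t)` tend to `0` as `R → ∞`.
[cite: Ellithy2026, §4.1 p. 38] -/
def IsRestFrame (Tlo : ℝ) : Prop :=
  ∀ t, Tlo < t → ∀ i : Fin 3, Tendsto (S.sliceMomentumFlux t i) atTop (𝓝 0)

end ADMTailTuple

/-! ### Definition 4.4, bullet 1: the late chart has the general ADM form with tuple `𝒮` -/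

section Chart

variable {EM : Type*} [NormedAddCommGroup EM] [NormedSpace ℝ EM] {HM : Type*}
  [TopologicalSpace HM] (I : ModelWithCorners ℝ EM HM) {M : Type*} [TopologicalSpace M]
  [ChartedSpace HM M]

/-- **The late chart read in Cartesian slice coordinates**: `(t, y) ↦ Φ(t, ‖y‖, y/‖y‖)` (the
identification `M = E3 ∖ B̄_{r₀} ≅ (r₀, ∞) × S²` of §3.1, p. 20). [cite: Ellithy2026, §3.1 p. 20] -/
def polarChart (Φ : ℝ × ℝ × sphere (0 : E3) 1 → M) : ℝ × E3 → M :=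
  fun q ↦ Φ (q.1, ‖q.2‖, raySphere q.2)

/-- **"On the exterior region `r > r₀`, the metric takes the general ADM form" with coefficient tuple
`𝒮`** (Ellithy 2026, Def. 4.4, bullet 1, p. 39): for `t > T̲` and `‖y‖ > r₀`, the pullback of `g`
along the chart (polar composite, flat model `𝓘(ℝ, ℝ × E3)`) is the ADM `4`-form of `𝒮` at `(t, y)`
(`ADMTailTuple.admForm`: `-(N² - |β|²_{g(t)}) dt² + 2 β ⊙ dt + g(t)`).
[cite: Ellithy2026, Def. 4.4 p. 39] -/
def HasADMForm (g : Π x : M, TangentSpace I x →L[ℝ] TangentSpace I x →L[ℝ] ℝ)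
    (Φ : ℝ × ℝ × sphere (0 : E3) 1 → M) (Tlo r₀ : ℝ) (S : ADMTailTuple) : Prop :=
  ∀ (t : ℝ) (y : E3), Tlo < t → r₀ < ‖y‖ →
    pullbackBilin (I := I) (I' := 𝓘(ℝ, ℝ × E3)) (polarChart Φ) g (t, y) = S.admForm t y

/-- **The analytic clauses of the quasi final state hypothesis for the late chart `Φ`**
(Ellithy 2026, Def. 4.4, bullet 1 (ADM form on `r > r₀`, coefficient tuple in `𝒞𝒮♯_{-τ}(ℳ)`,
`ℳ = (T̲, ∞) × (r₀, ∞) × S²`) and bullet 2 (late-time gauge reducibility, Def. 3.29, and forcing decay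
(A1) ∧ ((A2) ∨ (A3)), Def. 3.28), p. 39, with the slices adapted to the ADM rest frame, §4.1, p. 38):
`r₀ > 0` and there exist a Hölder exponent `α ∈ (0, 1)` (§3.1), an order `τ ∈ (1/2, 1)` and a
coefficient tuple `𝒮 = (N, λ, β, b, γ)` such that `Φ^* g` is the ADM form of `𝒮`, `𝒮 ∈ 𝒞𝒮♯_{-τ}(ℳ)`,
`𝒮` is late-time gauge reducible, satisfies the late forcing decay, and every slice has vanishing
ADM linear momentum. (The print's `T̲ > 0` is a normalisation of the time origin and is not imposed.)
[cite: Ellithy2026, Def. 4.4 p. 39] -/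
def IsQuasiFinalAnalytic (g : Π x : M, TangentSpace I x →L[ℝ] TangentSpace I x →L[ℝ] ℝ)
    (Φ : ℝ × ℝ × sphere (0 : E3) 1 → M) (Tlo r₀ : ℝ) : Prop :=
  0 < r₀ ∧ ∃ α ∈ Ioo (0 : ℝ) 1, ∃ τ ∈ Ioo (1 / 2 : ℝ) 1, ∃ S : ADMTailTuple,
    HasADMForm I g Φ Tlo r₀ S ∧
    S.IsSharpTailCoeff α τ Tlo r₀ ∧
    S.IsGaugeReducible α τ Tlo r₀ ∧
    S.HasLateForcingDecay α τ Tlo r₀ ∧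
    S.IsRestFrame Tlo

variable {I}

/-- Unpacking: a quasi-final-analytic chart has `r₀ > 0`. [cite: Ellithy2026, Def. 4.4 p. 39] -/
theorem IsQuasiFinalAnalytic.r₀_pos {g : Π x : M, TangentSpace I x →L[ℝ] TangentSpace I x →L[ℝ] ℝ}
    {Φ : ℝ × ℝ × sphere (0 : E3) 1 → M} {Tlo r₀ : ℝ} (h : IsQuasiFinalAnalytic I g Φ Tlo r₀) :
    0 < r₀ := h.1

/-- Unpacking: the data `(α, τ, 𝒮)` of a quasi-final-analytic chart with all clauses of Def. 4.4
(1, tail class)+(2) and §4.1. [cite: Ellithy2026, Def. 4.4 p. 39] -/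
theorem IsQuasiFinalAnalytic.exists_tuple
    {g : Π x : M, TangentSpace I x →L[ℝ] TangentSpace I x →L[ℝ] ℝ}
    {Φ : ℝ × ℝ × sphere (0 : E3) 1 → M} {Tlo r₀ : ℝ} (h : IsQuasiFinalAnalytic I g Φ Tlo r₀) :
    ∃ α τ : ℝ, α ∈ Ioo (0 : ℝ) 1 ∧ τ ∈ Ioo (1 / 2 : ℝ) 1 ∧ ∃ S : ADMTailTuple,
      HasADMForm I g Φ Tlo r₀ S ∧ S.IsSharpTailCoeff α τ Tlo r₀ ∧ S.IsGaugeReducible α τ Tlo r₀ ∧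
        S.HasLateForcingDecay α τ Tlo r₀ ∧ S.IsRestFrame Tlo := by
  obtain ⟨_, α, hα, τ, hτ, S, h1, h2, h3, h4, h5⟩ := h
  exact ⟨α, τ, hα, hτ, S, h1, h2, h3, h4, h5⟩

end Chart

/-! ### Functionality of the ADM form: the coefficient tuple of a chart is unique -/

section Functionality

namespace ADMTailTuple

variable {S S' : ADMTailTuple}

/-- `Π_p X = X - ⟪p, X⟫ p`. [folklore] -/
private theorem sphereTanProj_apply'' (p X : E3) : sphereTanProj p X = X - ⟪p, X⟫ • p := by
  simp [sphereTanProj, ContinuousLinearMap.smulRight_apply, innerSL_apply_apply]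

/-- `Π_p p = 0` for a unit vector. [folklore] -/
private theorem sphereTanProj_self (p : sphere (0 : E3) 1) : sphereTanProj (p : E3) (p : E3) = 0 := by
  have hp : ‖(p : E3)‖ = 1 := by simp
  rw [sphereTanProj_apply'', real_inner_self_eq_norm_sq, hp, one_pow, one_smul, sub_self]

/-- `⟪p, Π_p X⟫ = 0` for a unit vector. [folklore] -/
private theorem inner_sphereTanProj' (p : sphere (0 : E3) 1) (X : E3) :
    ⟪(p : E3), sphereTanProj (p : E3) X⟫ = 0 := by
  have hp : ‖(p : E3)‖ = 1 := by simp
  rw [sphereTanProj_apply'', inner_sub_right, inner_smul_right, real_inner_self_eq_norm_sq, hp,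
    one_pow, mul_one, sub_self]

/-- `Π_p (Π_p X) = Π_p X` for a unit vector. [folklore] -/
private theorem sphereTanProj_idem (p : sphere (0 : E3) 1) (X : E3) :
    sphereTanProj (p : E3) (sphereTanProj (p : E3) X) = sphereTanProj (p : E3) X := by
  conv_lhs => rw [sphereTanProj_apply'']
  rw [inner_sphereTanProj', zero_smul, sub_zero]

/-- `angVel y p = 0` for `p = ray y`: the radial direction has no angular velocity. [folklore] -/
private theorem angVel_ray (y : E3) : angVel y (raySphere y : E3) = 0 := by
  simp [angVel]

/-- `angVel y (Π Z) = ‖y‖⁻¹ Π Z`. [folklore] -/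
private theorem angVel_tan (y Z : E3) :
    angVel y (sphereTanProj (raySphere y : E3) Z) = ‖y‖⁻¹ • sphereTanProj (raySphere y : E3) Z := by
  simp [angVel, inner_sub_right, inner_smul_right]

/-- The ADM form on two purely spatial vectors is the slice metric. [cite: Ellithy2026, §3.1 p. 21] -/
private theorem admForm_apply_spatial (S : ADMTailTuple) (t : ℝ) (y X X' : E3) :
    S.admForm t y ((0 : ℝ), X) ((0 : ℝ), X') = S.gCart t y X X' := by
  simp [admForm]

/-- The ADM form on `∂_t` and a spatial vector is the shift. [cite: Ellithy2026, §3.1 p. 21] -/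
private theorem admForm_apply_dt_spatial (S : ADMTailTuple) (t : ℝ) (y X' : E3) :
    S.admForm t y ((1 : ℝ), (0 : E3)) ((0 : ℝ), X') = S.βCart t y X' := by
  simp [admForm]

/-- The ADM form on `(∂_t, ∂_t)`. [cite: Ellithy2026, §3.1 p. 21] -/
private theorem admForm_apply_dt_dt' (S : ADMTailTuple) (t : ℝ) (y : E3) :
    S.admForm t y ((1 : ℝ), (0 : E3)) ((1 : ℝ), (0 : E3)) =
      -(S.N t ‖y‖ (raySphere y) ^ 2 - S.betaNormSq t y) := by
  simp [admForm]

/-- The slice metric on `(p, p)`, `p = ray y`: `λ² + |b|²_γ`. [cite: Ellithy2026, §3.1 p. 21] -/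
private theorem gCart_apply_ray_ray (S : ADMTailTuple) (t : ℝ) (y : E3) :
    S.gCart t y (raySphere y : E3) (raySphere y : E3) =
      S.lam t ‖y‖ (raySphere y) ^ 2 + S.gammaNormSq t ‖y‖ (raySphere y) (S.b t ‖y‖ (raySphere y)) := by
  simp [gCart, angVel_ray]

/-- The slice metric on `(p, Π Z)`: `‖y‖⁻¹ b(Π Z)`. [cite: Ellithy2026, §3.1 p. 21] -/
private theorem gCart_apply_ray_tan (S : ADMTailTuple) (t : ℝ) (y Z : E3) :
    S.gCart t y (raySphere y : E3) (sphereTanProj (raySphere y : E3) Z) =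
      ‖y‖⁻¹ * S.b t ‖y‖ (raySphere y) (sphereTanProj (raySphere y : E3) Z) := by
  simp [gCart, angVel, map_sub, map_smul, mul_sub]
  ring

/-- The slice metric on `(Π Z, Π Z')`: `‖y‖⁻² γ(Π Z, Π Z')`. [cite: Ellithy2026, §3.1 p. 21] -/
private theorem gCart_apply_tan_tan (S : ADMTailTuple) (t : ℝ) (y Z Z' : E3) :
    S.gCart t y (sphereTanProj (raySphere y : E3) Z) (sphereTanProj (raySphere y : E3) Z') =
      ‖y‖⁻¹ * (‖y‖⁻¹ * S.γ t ‖y‖ (raySphere y) (sphereTanProj (raySphere y : E3) Z)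
        (sphereTanProj (raySphere y : E3) Z')) := by
  simp [gCart, angVel, map_sub, map_smul]
  ring

/-- The shift on `p`: `β_r`. [cite: Ellithy2026, §3.1 p. 21] -/
private theorem βCart_apply_ray (S : ADMTailTuple) (t : ℝ) (y : E3) :
    S.βCart t y (raySphere y : E3) = S.βr t ‖y‖ (raySphere y) := by
  simp [βCart, angVel_ray]

/-- The shift on `Π Z`: `‖y‖⁻¹ β^T(Π Z)`. [cite: Ellithy2026, §3.1 p. 21] -/
private theorem βCart_apply_tan (S : ADMTailTuple) (t : ℝ) (y Z : E3) :
    S.βCart t y (sphereTanProj (raySphere y : E3) Z) =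
      ‖y‖⁻¹ * S.βT t ‖y‖ (raySphere y) (sphereTanProj (raySphere y : E3) Z) := by
  simp [βCart, angVel, map_sub, map_smul, mul_sub]
  ring

/-- **Functionality of the ADM form at a point** (Ellithy 2026, §3.1, p. 21: the coefficients
`N, λ, β, b, γ` are read off the metric in the chart): if two tuples, both well formed at
`(t, ‖y‖, ray y)` (tangential `β^T`, `b`, `γ`) and both with positive lapses `N, λ` there, have the
same ADM `4`-form at `(t, y)`, `y ≠ 0`, then all their coefficients agree at `(t, ‖y‖, ray y)`.
[cite: Ellithy2026, §3.1 p. 21] -/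
theorem eq_of_admForm_eq {t : ℝ} {y : E3} (hy : y ≠ 0)
    (hT : S.βT t ‖y‖ (raySphere y) = (S.βT t ‖y‖ (raySphere y)).comp (sphereTanProj (raySphere y : E3)))
    (hb : S.b t ‖y‖ (raySphere y) = (S.b t ‖y‖ (raySphere y)).comp (sphereTanProj (raySphere y : E3)))
    (hγ : S.γ t ‖y‖ (raySphere y) = (S.γ t ‖y‖ (raySphere y)).bilinearComp
      (sphereTanProj (raySphere y : E3)) (sphereTanProj (raySphere y : E3)))
    (hT' : S'.βT t ‖y‖ (raySphere y) =
      (S'.βT t ‖y‖ (raySphere y)).comp (sphereTanProj (raySphere y : E3)))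
    (hb' : S'.b t ‖y‖ (raySphere y) = (S'.b t ‖y‖ (raySphere y)).comp (sphereTanProj (raySphere y : E3)))
    (hγ' : S'.γ t ‖y‖ (raySphere y) = (S'.γ t ‖y‖ (raySphere y)).bilinearComp
      (sphereTanProj (raySphere y : E3)) (sphereTanProj (raySphere y : E3)))
    (hN : 0 < S.N t ‖y‖ (raySphere y)) (hN' : 0 < S'.N t ‖y‖ (raySphere y))
    (hl : 0 < S.lam t ‖y‖ (raySphere y)) (hl' : 0 < S'.lam t ‖y‖ (raySphere y))
    (h : S.admForm t y = S'.admForm t y) :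
    S.N t ‖y‖ (raySphere y) = S'.N t ‖y‖ (raySphere y) ∧
      S.lam t ‖y‖ (raySphere y) = S'.lam t ‖y‖ (raySphere y) ∧
      S.βr t ‖y‖ (raySphere y) = S'.βr t ‖y‖ (raySphere y) ∧
      S.βT t ‖y‖ (raySphere y) = S'.βT t ‖y‖ (raySphere y) ∧
      S.b t ‖y‖ (raySphere y) = S'.b t ‖y‖ (raySphere y) ∧
      S.γ t ‖y‖ (raySphere y) = S'.γ t ‖y‖ (raySphere y) := by
  have hr : ‖y‖ ≠ 0 := norm_ne_zero_iff.mpr hy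
  set r := ‖y‖ with hr_def
  set p := raySphere y with hp_def
  -- (1) the slice metrics agree, (2) the shifts agree
  have hg : S.gCart t y = S'.gCart t y := by
    ext X X'
    rw [← admForm_apply_spatial S, ← admForm_apply_spatial S', h]
  have hβ : S.βCart t y = S'.βCart t y := by
    ext X'
    rw [← admForm_apply_dt_spatial S, ← admForm_apply_dt_spatial S', h]
  -- (3) γ agree: tangential block of the slice metric
  have hγeq : S.γ t r p = S'.γ t r p := by
    rw [hγ, hγ']
    ext Z Z'
    simp only [ContinuousLinearMap.bilinearComp_apply]
    have h1 := gCart_apply_tan_tan S t y Z Z'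
    have h2 := gCart_apply_tan_tan S' t y Z Z'
    rw [hg] at h1
    have h3 := h1.symm.trans h2
    have hinv : (‖y‖⁻¹ : ℝ) ≠ 0 := inv_ne_zero hr
    exact mul_left_cancel₀ hinv (mul_left_cancel₀ hinv h3)
  -- (4) b agree
  have hbeq : S.b t r p = S'.b t r p := by
    rw [hb, hb']
    ext Z
    simp only [ContinuousLinearMap.comp_apply]
    have h1 := gCart_apply_ray_tan S t y Z
    have h2 := gCart_apply_ray_tan S' t y Z
    rw [hg] at h1
    exact mul_left_cancel₀ (inv_ne_zero hr) (h1.symm.trans h2)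
  -- (5) λ agree: `λ² + |b|²_γ` is the `(p,p)` entry, and `|b|²_γ` depends on `γ, b` only
  have hnb : S.gammaNormSq t r p (S.b t r p) = S'.gammaNormSq t r p (S'.b t r p) := by
    simp only [gammaNormSq, gammaSharp, gammaHat, gammaTan, hγeq, hbeq]
  have hleq : S.lam t r p = S'.lam t r p := by
    have h1 := gCart_apply_ray_ray S t y
    have h2 := gCart_apply_ray_ray S' t y
    rw [hg] at h1
    have h3 : S.lam t r p ^ 2 = S'.lam t r p ^ 2 := by
      have := h1.symm.trans h2; rw [hnb] at this; linarith
    exact (pow_left_inj₀ hl.le hl'.le two_ne_zero).mp h3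
  -- (6) β_r and β^T agree
  have hβr : S.βr t r p = S'.βr t r p := by
    rw [← βCart_apply_ray S, ← βCart_apply_ray S', hβ]
  have hβT : S.βT t r p = S'.βT t r p := by
    rw [hT, hT']
    ext Z
    simp only [ContinuousLinearMap.comp_apply]
    have h1 := βCart_apply_tan S t y Z
    have h2 := βCart_apply_tan S' t y Z
    rw [hβ] at h1
    exact mul_left_cancel₀ (inv_ne_zero hr) (h1.symm.trans h2)
  -- (7) N agree: `N² - |β|²_{g(t)}` is the `dt²` entry and `|β|²_{g(t)}` depends on `β, g(t)` only
  have hbn : S.betaNormSq t y = S'.betaNormSq t y := by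
    simp only [betaNormSq, hg, hβ]
  have hNeq : S.N t r p = S'.N t r p := by
    have h1 := admForm_apply_dt_dt' S t y
    have h2 := admForm_apply_dt_dt' S' t y
    rw [h] at h1
    have h3 : S.N t r p ^ 2 = S'.N t r p ^ 2 := by
      have := h1.symm.trans h2; rw [hbn] at this; linarith
    exact (pow_left_inj₀ hN.le hN'.le two_ne_zero).mp h3
  exact ⟨hNeq, hleq, hβr, hβT, hbeq, hγeq⟩

end ADMTailTuple

variable {EM : Type*} [NormedAddCommGroup EM] [NormedSpace ℝ EM] {HM : Type*}
  [TopologicalSpace HM] {I : ModelWithCorners ℝ EM HM} {M : Type*} [TopologicalSpace M]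
  [ChartedSpace HM M] {g : Π x : M, TangentSpace I x →L[ℝ] TangentSpace I x →L[ℝ] ℝ}
  {Φ : ℝ × ℝ × sphere (0 : E3) 1 → M} {Tlo r₀ : ℝ} {S S' : ADMTailTuple}

/-- **The coefficient tuple of a late chart is unique** (functionality of `HasADMForm`; Ellithy
2026, §3.1, p. 21 / Def. 4.4 (1), p. 39: "the metric takes the general ADM form … and the
coefficient tuple …"): two tuples presenting `Φ^* g` in ADM form on `{t > T̲} × {|y| > r₀}`,
`r₀ ≥ 0`, both well formed there (Def. 3.6's standing conventions) and both with positive lapses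
`N, λ` there (as under Def. 3.6 (ii)), agree at every `(t, ‖y‖, ray y)`, `t > T̲`, `‖y‖ > r₀`.
[cite: Ellithy2026, Def. 4.4 p. 39] -/
theorem HasADMForm.coeff_unique (hr₀ : 0 ≤ r₀) (h : HasADMForm I g Φ Tlo r₀ S)
    (h' : HasADMForm I g Φ Tlo r₀ S') (hw : S.IsWellFormedOn Tlo r₀) (hw' : S'.IsWellFormedOn Tlo r₀)
    (hpos : ∀ (t r : ℝ) (p : sphere (0 : E3) 1), Tlo < t → r₀ < r → 0 < S.N t r p ∧ 0 < S.lam t r p)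
    (hpos' : ∀ (t r : ℝ) (p : sphere (0 : E3) 1), Tlo < t → r₀ < r → 0 < S'.N t r p ∧ 0 < S'.lam t r p)
    {t : ℝ} {y : E3} (ht : Tlo < t) (hy : r₀ < ‖y‖) :
    S.N t ‖y‖ (raySphere y) = S'.N t ‖y‖ (raySphere y) ∧
      S.lam t ‖y‖ (raySphere y) = S'.lam t ‖y‖ (raySphere y) ∧
      S.βr t ‖y‖ (raySphere y) = S'.βr t ‖y‖ (raySphere y) ∧
      S.βT t ‖y‖ (raySphere y) = S'.βT t ‖y‖ (raySphere y) ∧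
      S.b t ‖y‖ (raySphere y) = S'.b t ‖y‖ (raySphere y) ∧
      S.γ t ‖y‖ (raySphere y) = S'.γ t ‖y‖ (raySphere y) := by
  have hy0 : y ≠ 0 := by
    intro h0; rw [h0, norm_zero] at hy; exact absurd hy (not_lt.mpr hr₀)
  obtain ⟨hT, hb, hγ, -, -⟩ := hw t ‖y‖ (raySphere y) ht hy
  obtain ⟨hT', hb', hγ', -, -⟩ := hw' t ‖y‖ (raySphere y) ht hy
  obtain ⟨hN, hl⟩ := hpos t ‖y‖ (raySphere y) ht hy
  obtain ⟨hN', hl'⟩ := hpos' t ‖y‖ (raySphere y) ht hy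
  exact ADMTailTuple.eq_of_admForm_eq hy0 hT hb hγ hT' hb' hγ' hN hN' hl hl' ((h t y ht hy).symm.trans (h' t y ht hy))

end Functionality

end Literature.Geometry.Lorentzian

end
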